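import Literature.AnabelianGeometry.EtaleTheta.DivisorMonoidsOfGaloisCoveringCoset
import Literature.AnabelianGeometry.EtaleTheta.Discharge.Sec3BLambdaInjectiveOfRlf
import Literature.AlgebraicGeometry.Frobenioids.QuasiTemperoidConnected
import Literature.AnabelianGeometry.SemiGraphs.CosetCategoriesBridge
import HarnessLib

/-!
# [EtTh] Def. 3.3 (iii), step 5: the Def. 3.3 (iii) data DIRECTLY over print's `D₀ = B^temp(Γ)⁰` — base change of the
# Galois-covering data along `B^temp(Γ)⁰ ⥤ (Γ-sets)` (class (b) construction; the TEMPERED model of `D₀`)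

S. Mochizuki, *The étale theta function …*, Publ. RIMS **45** (2009) [MochizukiEtTh2009], §3 p.72 («`D₀ := B^temp(X^log)⁰` …
connected objects»; «a connected tempered covering … determines an OPEN subgroup»), Def. 3.3 (iii) p.73
[cite: MochizukiEtTh2009, Def 3.3 p.73]; S. Mochizuki, *Semi-graphs of anabelioids* (2006) [MochizukiSemiAnbd2006], §3 p.33
(`B^temp(Γ)`: countable discrete sets with continuous `Γ`-action); [FrdII] Ex. 1.3.

abc-iut cell, block C / W6, seat abc-iut-w6-d048 (gen 3); L2-lead R398 (2026-08-26T13:14Z): repair of the kernel finding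
F-w6d048g3-2 — `BiKummerSetting.Thm44Hyp.baseShape` («`D_i := B^temp(X_i^log)[𝒟_i]`»: base functor FULLY FAITHFUL onto the
objects over some `𝒟`) cannot be met by a tempered Frobenioid whose Def. 3.3 (iii) data live over the connected / coset
`G`-SET models (`DivisorMonoids.ofGaloisActionConnected/Coset`), because those models contain the `Γ`-sets with NON-open
stabilisers (audit note N1) while `D = B^temp(Γ)⁰` does not.  CLASS (b) CONSTRUCTION (one functor + one constructor def; the
frozen `DivisorMonoids`, abc-iut-w6-d058's `ofGaloisAction` and abc-iut-w5-d179's `precomp` consumed BY NAME):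
* `temperedInclusion Γ : ConnectedPart (BTemp Γ) ⥤ Action (Type u) Γ` — the composite of the two full inclusions;
* **`DivisorMonoids.ofGaloisActionTempered A hZ := (ofGaloisAction A hZ).precomp (temperedInclusion Γ)`** — for a Galois action
  `A : Z.GaloisAction Γ` of the tempered group ITSELF (`G := Γ`; e.g. the trivial action on the one-component model, or any action
  through a quotient `Γ ↠ Gal(Z_∞/X)`): the Def. 3.3 (iii) data over `D₀ = B^temp(Γ)⁰` ON THE NOSE — only countable `Γ`-sets with
  OPEN stabilisers (connected tempered coverings), retiring N1;
* THEOREMS: every object of `B^temp(Γ)⁰` is a nonempty transitive `Γ`-set (`isConnectedGSet_temperedInclusion`, abc-iut-L2/L3's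
  `QuasiTemperoid.BTempConnected.isConnectedObj_iff`), so covering maps are onto and the transition maps of `B₀` / `Φ₀` are
  injective (`…_B₀_map_injective`, `…_Φ₀_map_injective`), `Φ₀`'s reflect divisibility (`…_Φ₀_map_reflects_dvd`, this seat's
  `phiZeroPull_reflects_dvd`), every `Φ₀(Y)` is weakly perf-factorial with cofinal perfection (`…_isPerfFactorialCof`); hence
  `hBinj` at `ofRlfZWeak` / `ofRlfQWeak` / `ofRlfRWeak` of these data (`…_ofRlf{Z,Q,R}Weak_hBinj`).
* **SMALL MODEL** `DivisorMonoids.ofGaloisActionCosetCat hΓ A hZ := (ofGaloisActionTempered A hZ).precomp (CosetCat.toConnected hΓ)`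
  — the same data over abc-iut-L5-t2's SMALL coset category `CosetCat Γ` (objects the OPEN subgroups, [FrdII] Ex. 1.3 (i)), which
  abc-iut's `CosetCat.equivConnectedPart hΓ : CosetCat Γ ≌ ConnectedPart (BTemp Γ)` identifies with `B^temp(Γ)⁰` for tempered `Γ`.
  WHY BOTH: `ConnectedPart (BTemp Γ) : Type (u+1)` while the §4 interface `BiKummerSetting X T₀ D VD` binds `{D₀ : Type u₀}` in
  the universe of the field `K` — so the §4 setting over constructed data must read its Def. 3.3 (iii) data over the small
  model; the one-liners transfer verbatim (`ofGaloisActionCosetCat_*`).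
HONEST FRAMING: one term of the Def. 3.3 (iii) limit (Rmk. 3.3.1); `LogDivisorModel` / `GaloisAction` / `CuspLaws` are interface and
parameter records (nothing asserts they arise from a curve); no named Prop fact, no instance, no sorry; nothing here bears on
[IUTchIII] Cor. 3.12; typed ≠ proved.
-/

namespace Literature.AnabelianGeometry.EtaleTheta

open CategoryTheory Opposite Function Literature.AlgebraicGeometry.Frobenioids Literature.AnabelianGeometry.SemiGraphs

universe u

namespace LogDivisorModel.GaloisAction

variable (Γ : Type u) [Group Γ] [TopologicalSpace Γ]

/-- **`B^temp(Γ)⁰ ⥤ (Γ-sets)`**: the inclusion of the connected tempered coverings into all `Γ`-sets (composite of the full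
inclusions `B^temp(Γ)⁰ ⊆ B^temp(Γ) ⊆ Action (Type u) Γ`). [cite: MochizukiSemiAnbd2006, §3 p.33] -/
def temperedInclusion : ConnectedPart (BTemp Γ) ⥤ Action (Type u) Γ :=
  (connectedObjects (BTemp Γ)).ι ⋙ (temperedAction Γ).ι

/-- On objects the inclusion is the underlying `Γ`-set. [cite: MochizukiSemiAnbd2006, §3 p.33] -/
@[simp] theorem temperedInclusion_obj (A : ConnectedPart (BTemp Γ)) : (temperedInclusion Γ).obj A = A.obj.obj := rfl

/-- On morphisms the inclusion is the underlying `Γ`-map. [cite: MochizukiSemiAnbd2006, §3 p.33] -/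
@[simp] theorem temperedInclusion_map {A B : ConnectedPart (BTemp Γ)} (f : A ⟶ B) :
    (temperedInclusion Γ).map f = f.hom.hom := rfl

variable {Γ}

/-- **Every object of `B^temp(Γ)⁰` is a connected covering** in the `G`-set sense (nonempty, one `Γ`-orbit) — [FrdII] Ex. 1.3
(`QuasiTemperoid.BTempConnected.isConnectedObj_iff`). [cite: MochizukiFrdII2008, Ex 1.3 (ii) p.11] -/
theorem isConnectedGSet_temperedInclusion (A : ConnectedPart (BTemp Γ)) : isConnectedGSet ((temperedInclusion Γ).obj A) :=
  (QuasiTemperoid.BTempConnected.isConnectedObj_iff A.obj).mp A.property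

/-- Covering maps between connected tempered coverings are onto. [cite: MochizukiFrdII2008, Ex 1.3 (ii) p.11] -/
theorem hom_surjective_temperedInclusion {A B : ConnectedPart (BTemp Γ)} (f : A ⟶ B) :
    Function.Surjective ((temperedInclusion Γ).map f).hom :=
  hom_surjective_of_isConnectedGSet (isConnectedGSet_temperedInclusion A) (isConnectedGSet_temperedInclusion B) _

/-- The stabilisers of a connected tempered covering are OPEN (print: «a connected tempered covering … determines an open
subgroup»; this is what the `G`-set models do not see). [cite: MochizukiEtTh2009, Def 3.3 p.73] -/
theorem isOpen_stabilizer_temperedInclusion (A : ConnectedPart (BTemp Γ)) (x : A.obj.obj.V) :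
    IsOpen {g : Γ | A.obj.obj.ρ g x = x} :=
  A.obj.property.2 x

end LogDivisorModel.GaloisAction

namespace DivisorMonoids

open LogDivisorModel.GaloisAction

variable {Γ : Type u} [Group Γ] [TopologicalSpace Γ] {Z : LogDivisorModel.{u}} (A : Z.GaloisAction Γ) (hZ : Z.CuspLaws)

/-- **Def. 3.3 (iii) data DIRECTLY over `D₀ = B^temp(Γ)⁰`** for a Galois action of the tempered group `Γ` on `Z^log_∞`: the base
change of `ofGaloisAction A hZ` along `temperedInclusion Γ` — at a connected tempered covering `A`, `Φ₀(A) = Hom_Γ(A, Div⁺(Z^log_∞))`,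
`B₀(A) = Hom_Γ(A, Mero(Z^log_∞))`, `div₀`, `F₀`, … as constructed by abc-iut-w6-d058. [cite: MochizukiEtTh2009, Def 3.3 p.73] -/
noncomputable def ofGaloisActionTempered : DivisorMonoids.{u + 1, u, u} (ConnectedPart (BTemp Γ)) :=
  (ofGaloisAction A hZ).precomp (temperedInclusion Γ)

/-- It IS the base change (by definition). [cite: MochizukiEtTh2009, Def 3.3 p.73] -/
theorem ofGaloisActionTempered_eq : ofGaloisActionTempered A hZ = (ofGaloisAction A hZ).precomp (temperedInclusion Γ) := rfl

/-- `Φ₀(A)` of the tempered model is `Hom_Γ(A, Div⁺(Z^log_∞))`. [cite: MochizukiEtTh2009, Def 3.3 p.73] -/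
theorem ofGaloisActionTempered_Φ₀_obj (Y : (ConnectedPart (BTemp Γ))ᵒᵖ) :
    (ofGaloisActionTempered A hZ).Φ₀.obj Y = A.PhiZero.obj (op Y.unop.obj.obj) := rfl

/-- `B₀(A)` of the tempered model is `Hom_Γ(A, Mero(Z^log_∞))`. [cite: MochizukiEtTh2009, Def 3.3 p.73] -/
theorem ofGaloisActionTempered_B₀_obj (Y : (ConnectedPart (BTemp Γ))ᵒᵖ) :
    (ofGaloisActionTempered A hZ).B₀.obj Y = A.BZero.obj (op Y.unop.obj.obj) := rfl

/-- **The transition maps of `B₀` are injective over `B^temp(Γ)⁰`** (inclusions of invariants; covering maps onto).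
[cite: MochizukiEtTh2009, Def 3.3 p.73] -/
theorem ofGaloisActionTempered_B₀_map_injective {Y Y' : (ConnectedPart (BTemp Γ))ᵒᵖ} (f : Y ⟶ Y') :
    Function.Injective ((ofGaloisActionTempered A hZ).B₀.map f).hom :=
  A.bZeroPull_injective _ (hom_surjective_temperedInclusion f.unop)

/-- **The transition maps of `Φ₀` are injective over `B^temp(Γ)⁰`.** [cite: MochizukiEtTh2009, Def 3.3 p.73] -/
theorem ofGaloisActionTempered_Φ₀_map_injective {Y Y' : (ConnectedPart (BTemp Γ))ᵒᵖ} (f : Y ⟶ Y') :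
    Function.Injective ((ofGaloisActionTempered A hZ).Φ₀.map f).hom :=
  A.phiZeroPull_injective _ (hom_surjective_temperedInclusion f.unop)

/-- **The transition maps of `Φ₀` reflect divisibility over `B^temp(Γ)⁰`.** [cite: MochizukiEtTh2009, Def 3.3 p.73] -/
theorem ofGaloisActionTempered_Φ₀_map_reflects_dvd {Y Y' : (ConnectedPart (BTemp Γ))ᵒᵖ} (f : Y ⟶ Y')
    (a b : (ofGaloisActionTempered A hZ).Φ₀.obj Y)
    (h : ((ofGaloisActionTempered A hZ).Φ₀.map f).hom a ∣ ((ofGaloisActionTempered A hZ).Φ₀.map f).hom b) : a ∣ b :=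
  A.phiZeroPull_reflects_dvd _ (hom_surjective_temperedInclusion f.unop) a b h

/-- **Prop. 3.4 (i), weak with cofinal perfection, for every `Φ₀(A)` of the tempered model** (abc-iut-w6-d057's
`isPerfFactorialCof_phiZero`). [cite: MochizukiEtTh2009, Prop 3.4 p.74] -/
theorem ofGaloisActionTempered_isPerfFactorialCof (Y : (ConnectedPart (BTemp Γ))ᵒᵖ) :
    IsPerfFactorialCof ((ofGaloisActionTempered A hZ).Φ₀.obj Y) :=
  A.isPerfFactorialCof_phiZero _

/-- `hBinj` at the `Λ = ℤ` weak Def. 3.6 (i) data of the tempered model — a THEOREM. [cite: MochizukiEtTh2009, Def 3.6 p.76] -/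
theorem ofGaloisActionTempered_ofRlfZWeak_hBinj
    (hpf : ∀ Y : (ConnectedPart (BTemp Γ))ᵒᵖ, IsPerfFactorialCof ((ofGaloisActionTempered A hZ).Φ₀.obj Y)) :
    ∀ {Y Y' : (ConnectedPart (BTemp Γ))ᵒᵖ} (g : Y ⟶ Y'),
      Injective ((RealifiedDivisorMonoids.ofRlfZWeak (ofGaloisActionTempered A hZ) hpf).BΛ.map g).hom :=
  RealifiedDivisorMonoids.ofRlfZWeak_hBinj _ hpf fun g => ofGaloisActionTempered_B₀_map_injective A hZ g

/-- `hBinj` at the `Λ = ℚ` weak data of the tempered model. [cite: MochizukiEtTh2009, Def 3.6 p.76] -/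
theorem ofGaloisActionTempered_ofRlfQWeak_hBinj
    (hpf : ∀ Y : (ConnectedPart (BTemp Γ))ᵒᵖ, IsPerfFactorialCof ((ofGaloisActionTempered A hZ).Φ₀.obj Y)) :
    ∀ {Y Y' : (ConnectedPart (BTemp Γ))ᵒᵖ} (g : Y ⟶ Y'),
      Injective ((RealifiedDivisorMonoids.ofRlfQWeak (ofGaloisActionTempered A hZ) hpf).BΛ.map g).hom :=
  RealifiedDivisorMonoids.ofRlfQWeak_hBinj _ hpf fun g => ofGaloisActionTempered_B₀_map_injective A hZ g

/-- `hBinj` at the `Λ = ℝ` weak data of the tempered model (this seat's divisibility-reflection route).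
[cite: MochizukiEtTh2009, Def 3.6 p.76] -/
theorem ofGaloisActionTempered_ofRlfRWeak_hBinj
    (hpf : ∀ Y : (ConnectedPart (BTemp Γ))ᵒᵖ, IsPerfFactorialCof ((ofGaloisActionTempered A hZ).Φ₀.obj Y)) :
    ∀ {Y Y' : (ConnectedPart (BTemp Γ))ᵒᵖ} (g : Y ⟶ Y'),
      Injective ((RealifiedDivisorMonoids.ofRlfRWeak (ofGaloisActionTempered A hZ) hpf).BΛ.map g).hom :=
  RealifiedDivisorMonoids.ofRlfRWeak_hBinj_of_reflects _ hpf (fun g => ofGaloisActionTempered_Φ₀_map_injective A hZ g)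
    fun g a b h => ofGaloisActionTempered_Φ₀_map_reflects_dvd A hZ g a b h

/-- **Non-vacuity**: the tempered-model data exist for every topological group `Γ` acting trivially on any
`LogDivisorModel` with cusp laws (e.g. the one-component model). [cite: MochizukiEtTh2009, Def 3.3 p.73] -/
theorem nonempty_ofGaloisActionTempered (Γ : Type) [Group Γ] [TopologicalSpace Γ] (Z : LogDivisorModel.{0}) (hZ : Z.CuspLaws) :
    Nonempty (DivisorMonoids.{1, 0, 0} (ConnectedPart (BTemp Γ))) :=
  ⟨ofGaloisActionTempered (LogDivisorModel.GaloisAction.trivial Z Γ) hZ⟩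

/-! ## The small model: the same data over `CosetCat Γ ≌ B^temp(Γ)⁰` (universe of `Γ`) -/

section Small

variable {Γ : Type u} [Group Γ] [TopologicalSpace Γ] [IsTopologicalGroup Γ] (hΓ : IsTempered Γ)
  {Z : LogDivisorModel.{u}} (A : Z.GaloisAction Γ) (hZ : Z.CuspLaws)

/-- **Def. 3.3 (iii) data over the SMALL model `CosetCat Γ` of `D₀ = B^temp(Γ)⁰`** (`Γ` tempered): base change of the
tempered model along `CosetCat.toConnected hΓ : CosetCat Γ ⥤ ConnectedPart (BTemp Γ)` (an equivalence,
`CosetCat.equivConnectedPart`).  At an open subgroup `H`: `Φ₀(H) = Hom_Γ(Γ/H, Div⁺(Z^log_∞)) = Div⁺(Z^log_∞)^H`.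
[cite: MochizukiEtTh2009, Def 3.3 p.73] -/
noncomputable def ofGaloisActionCosetCat : DivisorMonoids.{u, u, u} (CosetCat Γ) :=
  (ofGaloisActionTempered A hZ).precomp (CosetCat.toConnected hΓ)

/-- It IS the base change (by definition). [cite: MochizukiEtTh2009, Def 3.3 p.73] -/
theorem ofGaloisActionCosetCat_eq :
    ofGaloisActionCosetCat hΓ A hZ = (ofGaloisActionTempered A hZ).precomp (CosetCat.toConnected hΓ) := rfl

/-- `Φ₀(H)` of the small model is `Hom_Γ(Γ/H, Div⁺(Z^log_∞))`. [cite: MochizukiEtTh2009, Def 3.3 p.73] -/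
theorem ofGaloisActionCosetCat_Φ₀_obj (Y : (CosetCat Γ)ᵒᵖ) :
    (ofGaloisActionCosetCat hΓ A hZ).Φ₀.obj Y = A.PhiZero.obj (op ((CosetCat.toBTemp hΓ).obj Y.unop).obj) := rfl

/-- `B₀(H)` of the small model is `Hom_Γ(Γ/H, Mero(Z^log_∞))`. [cite: MochizukiEtTh2009, Def 3.3 p.73] -/
theorem ofGaloisActionCosetCat_B₀_obj (Y : (CosetCat Γ)ᵒᵖ) :
    (ofGaloisActionCosetCat hΓ A hZ).B₀.obj Y = A.BZero.obj (op ((CosetCat.toBTemp hΓ).obj Y.unop).obj) := rfl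

/-- The transition maps of `B₀` are injective over the small model. [cite: MochizukiEtTh2009, Def 3.3 p.73] -/
theorem ofGaloisActionCosetCat_B₀_map_injective {Y Y' : (CosetCat Γ)ᵒᵖ} (f : Y ⟶ Y') :
    Function.Injective ((ofGaloisActionCosetCat hΓ A hZ).B₀.map f).hom :=
  ofGaloisActionTempered_B₀_map_injective A hZ ((CosetCat.toConnected hΓ).map f.unop).op

/-- The transition maps of `Φ₀` are injective over the small model. [cite: MochizukiEtTh2009, Def 3.3 p.73] -/
theorem ofGaloisActionCosetCat_Φ₀_map_injective {Y Y' : (CosetCat Γ)ᵒᵖ} (f : Y ⟶ Y') :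
    Function.Injective ((ofGaloisActionCosetCat hΓ A hZ).Φ₀.map f).hom :=
  ofGaloisActionTempered_Φ₀_map_injective A hZ ((CosetCat.toConnected hΓ).map f.unop).op

/-- The transition maps of `Φ₀` reflect divisibility over the small model. [cite: MochizukiEtTh2009, Def 3.3 p.73] -/
theorem ofGaloisActionCosetCat_Φ₀_map_reflects_dvd {Y Y' : (CosetCat Γ)ᵒᵖ} (f : Y ⟶ Y')
    (a b : (ofGaloisActionCosetCat hΓ A hZ).Φ₀.obj Y)
    (h : ((ofGaloisActionCosetCat hΓ A hZ).Φ₀.map f).hom a ∣ ((ofGaloisActionCosetCat hΓ A hZ).Φ₀.map f).hom b) :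
    a ∣ b :=
  ofGaloisActionTempered_Φ₀_map_reflects_dvd A hZ ((CosetCat.toConnected hΓ).map f.unop).op a b h

/-- Prop. 3.4 (i), weak with cofinal perfection, for every `Φ₀(H)` of the small model. [cite: MochizukiEtTh2009, Prop 3.4 p.74] -/
theorem ofGaloisActionCosetCat_isPerfFactorialCof (Y : (CosetCat Γ)ᵒᵖ) :
    IsPerfFactorialCof ((ofGaloisActionCosetCat hΓ A hZ).Φ₀.obj Y) :=
  ofGaloisActionTempered_isPerfFactorialCof A hZ _

/-- `hBinj` at the `Λ = ℤ` weak data of the small model. [cite: MochizukiEtTh2009, Def 3.6 p.76] -/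
theorem ofGaloisActionCosetCat_ofRlfZWeak_hBinj
    (hpf : ∀ Y : (CosetCat Γ)ᵒᵖ, IsPerfFactorialCof ((ofGaloisActionCosetCat hΓ A hZ).Φ₀.obj Y)) :
    ∀ {Y Y' : (CosetCat Γ)ᵒᵖ} (g : Y ⟶ Y'),
      Injective ((RealifiedDivisorMonoids.ofRlfZWeak (ofGaloisActionCosetCat hΓ A hZ) hpf).BΛ.map g).hom :=
  RealifiedDivisorMonoids.ofRlfZWeak_hBinj _ hpf fun g => ofGaloisActionCosetCat_B₀_map_injective hΓ A hZ g

/-- `hBinj` at the `Λ = ℚ` weak data of the small model. [cite: MochizukiEtTh2009, Def 3.6 p.76] -/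
theorem ofGaloisActionCosetCat_ofRlfQWeak_hBinj
    (hpf : ∀ Y : (CosetCat Γ)ᵒᵖ, IsPerfFactorialCof ((ofGaloisActionCosetCat hΓ A hZ).Φ₀.obj Y)) :
    ∀ {Y Y' : (CosetCat Γ)ᵒᵖ} (g : Y ⟶ Y'),
      Injective ((RealifiedDivisorMonoids.ofRlfQWeak (ofGaloisActionCosetCat hΓ A hZ) hpf).BΛ.map g).hom :=
  RealifiedDivisorMonoids.ofRlfQWeak_hBinj _ hpf fun g => ofGaloisActionCosetCat_B₀_map_injective hΓ A hZ g

/-- `hBinj` at the `Λ = ℝ` weak data of the small model. [cite: MochizukiEtTh2009, Def 3.6 p.76] -/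
theorem ofGaloisActionCosetCat_ofRlfRWeak_hBinj
    (hpf : ∀ Y : (CosetCat Γ)ᵒᵖ, IsPerfFactorialCof ((ofGaloisActionCosetCat hΓ A hZ).Φ₀.obj Y)) :
    ∀ {Y Y' : (CosetCat Γ)ᵒᵖ} (g : Y ⟶ Y'),
      Injective ((RealifiedDivisorMonoids.ofRlfRWeak (ofGaloisActionCosetCat hΓ A hZ) hpf).BΛ.map g).hom :=
  RealifiedDivisorMonoids.ofRlfRWeak_hBinj_of_reflects _ hpf (fun g => ofGaloisActionCosetCat_Φ₀_map_injective hΓ A hZ g)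
    fun g a b h => ofGaloisActionCosetCat_Φ₀_map_reflects_dvd hΓ A hZ g a b h

include hΓ in
/-- **Non-vacuity of the small model** for every tempered `Γ` acting trivially on any `LogDivisorModel` with cusp laws.
[cite: MochizukiEtTh2009, Def 3.3 p.73] -/
theorem nonempty_ofGaloisActionCosetCat (Z : LogDivisorModel.{u}) (hZ : Z.CuspLaws) :
    Nonempty (DivisorMonoids.{u, u, u} (CosetCat Γ)) :=
  ⟨ofGaloisActionCosetCat hΓ (LogDivisorModel.GaloisAction.trivial Z Γ) hZ⟩

end Small

end DivisorMonoids

end Literature.AnabelianGeometry.EtaleTheta
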